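import Summits.Parity.GeneralizedHardyLittlewood.Theorems.FordMaynardSieveConst01651SieveConst01651BuchstabCert
import Literature.Analysis.Convolution.ConvolutionPowerIntegerArithmetic
import HarnessLib

/-!
# Route `FordMaynardSieveConst01651`, target `SieveConst01651` (stmt-Parity-19185), stub `stub_certValuePos` (R2):
# the packed block tables — the range lookups are lower / upper bounds of the cell values

Def-free helper file (step (6) of the `certP`/`certN` soundness, see `…CertAssembly`).  The checker packs the block
minima / maxima of the table's cell bounds in base `2⁴⁸` (`pack48`) and reads them with `digit48` / `rangeMin` /
`rangeMax`.  Here: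

* `pack48_eq_kpack` — `pack48 L` is the tree's Kronecker packing `kpack 48 |L| (L.getD · 0)`, so `digit48_pack48`:
  `digit48 (pack48 L) q = L_q` when all entries are `< 2⁴⁸` (`kdigit_kpack`);
* `rangeMin_le_digit` / `digit_le_rangeMax` — the range scans bound every digit in the range;
* `foldl_min_le_of_mem` / `foldl_min_eq_or_mem` / `le_foldl_max_mem`, `blockMin_getD_le` / `le_blockMax_getD` — block minima / maxima bound the
  cells of their block; `blockMin_lt` / `blockMax_lt` — the packed digits stay `< 2⁴⁸` when the cells do;
* `phiLoRange_le` / `le_phiHiRange` — **for every cell `m ∈ [lo, hi)` inside `[60000, 60000 + 16n)`, the lookup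
  `phiLoRange (pack48 (blockMin n L)) lo hi ≤ L_{m−60000}`** (resp. `≥` for the maxima), `L` any cell list with entries `< 2⁴⁸`.

References: [GathenGerhard2013ModernComputerAlgebra] §8.4 (Kronecker substitution); folklore.
-/

namespace Summit.Parity.GeneralizedHardyLittlewood.FordMaynardSieveConst01651SieveConst01651

open Literature.Analysis.Convolution

/-! ### Packing and digits -/

/-- `pack48` is the Kronecker packing of the list entries. [cite: GathenGerhard2013ModernComputerAlgebra, §8.4] -/
theorem pack48_eq_kpack : ∀ L : List ℕ, pack48 L = kpack 48 L.length (fun j => L.getD j 0)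
  | [] => by simp [pack48]
  | v :: L => by
    rw [pack48, pack48_eq_kpack L, List.length_cons, kpack_succ']
    simp only [List.getD_cons_zero]
    have : (fun i => (v :: L).getD (1 + i) 0) = fun i => L.getD i 0 := by
      funext i; rw [Nat.add_comm]; rfl
    rw [this]
    ring

/-- Reading an entry off the packed number (entries `< 2⁴⁸`). [cite: GathenGerhard2013ModernComputerAlgebra, §8.4] -/
theorem digit48_pack48 {L : List ℕ} (hL : ∀ j < L.length, L.getD j 0 < 2 ^ 48) (q : ℕ) :
    digit48 (pack48 L) q = L.getD q 0 := by
  rw [pack48_eq_kpack]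
  have h := kdigit_kpack (B := 48) (M := L.length) (d := fun j => L.getD j 0) hL q
  unfold kdigit at h
  unfold digit48
  rw [h]
  split_ifs with hq
  · rfl
  · rw [List.getD_eq_getElem?_getD, List.getElem?_eq_none (not_lt.1 hq)]; rfl

/-- The range minimum is below every digit of the range. [folklore] -/
theorem rangeMin_le_digit (N : ℕ) : ∀ (c q i : ℕ), i ≤ c → rangeMin N q c ≤ digit48 N (q + i)
  | 0, q, i, hi => by rw [Nat.le_zero.1 hi, Nat.add_zero]; exact le_rfl
  | c + 1, q, i, hi => by
    rw [rangeMin]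
    rcases Nat.eq_zero_or_pos i with rfl | hi0
    · exact min_le_left _ _
    · have h := rangeMin_le_digit N c (q + 1) (i - 1) (by omega)
      rw [show q + 1 + (i - 1) = q + i by omega] at h
      exact (min_le_right _ _).trans h

/-- The range maximum is above every digit of the range. [folklore] -/
theorem digit_le_rangeMax (N : ℕ) : ∀ (c q i : ℕ), i ≤ c → digit48 N (q + i) ≤ rangeMax N q c
  | 0, q, i, hi => by rw [Nat.le_zero.1 hi, Nat.add_zero]; exact le_rfl
  | c + 1, q, i, hi => by
    rw [rangeMax]
    rcases Nat.eq_zero_or_pos i with rfl | hi0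
    · exact le_max_left _ _
    · have h := digit_le_rangeMax N c (q + 1) (i - 1) (by omega)
      rw [show q + 1 + (i - 1) = q + i by omega] at h
      exact h.trans (le_max_right _ _)

/-! ### Block minima and maxima -/

/-- `foldl min a l` is below `a`. [folklore] -/
theorem foldl_min_le_init : ∀ (l : List ℕ) (a : ℕ), l.foldl min a ≤ a
  | [], a => le_rfl
  | x :: l, a => by rw [List.foldl_cons]; exact (foldl_min_le_init l _).trans (min_le_left _ _)

/-- `foldl min a l` is below every member of `l`. [folklore] -/
theorem foldl_min_le_of_mem : ∀ (l : List ℕ) (a : ℕ) {x : ℕ}, x ∈ l → l.foldl min a ≤ x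
  | [], a, x, hx => absurd hx List.not_mem_nil
  | y :: l, a, x, hx => by
    rw [List.foldl_cons]
    rcases List.mem_cons.1 hx with rfl | hx
    · exact (foldl_min_le_init l _).trans (min_le_right _ _)
    · exact foldl_min_le_of_mem l _ hx

/-- `foldl min a l` is `a` or a member of `l`. [folklore] -/
theorem foldl_min_eq_or_mem : ∀ (l : List ℕ) (a : ℕ), l.foldl min a = a ∨ l.foldl min a ∈ l
  | [], a => Or.inl rfl
  | x :: l, a => by
    rw [List.foldl_cons]
    rcases foldl_min_eq_or_mem l (min a x) with h | h
    · rw [h]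
      rcases min_choice a x with h' | h'
      · left; exact h'
      · right; rw [h']; exact List.mem_cons_self
    · right; exact List.mem_cons_of_mem _ h

/-- `foldl max a l` is above `a` and above every member, and is `a` or a member. [folklore] -/
theorem le_foldl_max_mem : ∀ (l : List ℕ) (a : ℕ),
    a ≤ l.foldl max a ∧ (∀ x ∈ l, x ≤ l.foldl max a) ∧ (l.foldl max a = a ∨ l.foldl max a ∈ l)
  | [], a => by simp
  | x :: l, a => by
    obtain ⟨h1, h2, h3⟩ := le_foldl_max_mem l (max a x)
    refine ⟨?_, fun y hy => ?_, ?_⟩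
    · rw [List.foldl_cons]; exact (le_max_left _ _).trans h1
    · rw [List.foldl_cons]
      rcases List.mem_cons.1 hy with rfl | hy
      · exact (le_max_right _ _).trans h1
      · exact h2 y hy
    · rw [List.foldl_cons]
      rcases h3 with h | h
      · rw [h]
        rcases max_choice a x with h' | h'
        · left; exact h'
        · right; rw [h']; exact List.mem_cons_self
      · right; exact List.mem_cons_of_mem _ h

/-- Members of `l.take 16` by index. [folklore] -/
theorem getD_mem_take {l : List ℕ} {i : ℕ} (hi : i < 16) (hil : i < l.length) : l.getD i 0 ∈ l.take 16 := by
  rw [List.getD_eq_getElem?_getD, List.getElem?_eq_getElem hil, Option.getD_some]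
  refine List.mem_iff_getElem.2 ⟨i, by simp; omega, ?_⟩
  rw [List.getElem_take]

/-- **Block minima bound the cells of the block**: `(blockMin n L)_q ≤ L_{16q+i}` (`q < n`, `i < 16`, index in range). [folklore] -/
theorem blockMin_getD_le : ∀ (n : ℕ) (L : List ℕ) (q i : ℕ), q < n → i < 16 → 16 * q + i < L.length →
    (blockMin n L).getD q 0 ≤ L.getD (16 * q + i) 0
  | 0, L, q, i, hq, _, _ => absurd hq (Nat.not_lt_zero q)
  | n + 1, L, q, i, hq, hi, hlen => by
    rw [blockMin]
    cases q with
    | zero =>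
      rw [List.getD_cons_zero, Nat.mul_zero, Nat.zero_add]
      exact foldl_min_le_of_mem (L.take 16) (L.headD 0) (getD_mem_take hi (by omega))
    | succ q =>
      rw [List.getD_cons_succ]
      have h := blockMin_getD_le n (L.drop 16) q i (by omega) hi (by rw [List.length_drop]; omega)
      rw [List.getD_eq_getElem?_getD, List.getD_eq_getElem?_getD, List.getElem?_drop] at h
      rw [List.getD_eq_getElem?_getD, List.getD_eq_getElem?_getD, show 16 * (q + 1) + i = 16 + (16 * q + i) by ring]
      exact h

/-- **Block maxima bound the cells of the block**: `L_{16q+i} ≤ (blockMax n L)_q`. [folklore] -/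
theorem le_blockMax_getD : ∀ (n : ℕ) (L : List ℕ) (q i : ℕ), q < n → i < 16 → 16 * q + i < L.length →
    L.getD (16 * q + i) 0 ≤ (blockMax n L).getD q 0
  | 0, L, q, i, hq, _, _ => absurd hq (Nat.not_lt_zero q)
  | n + 1, L, q, i, hq, hi, hlen => by
    rw [blockMax]
    cases q with
    | zero =>
      rw [List.getD_cons_zero, Nat.mul_zero, Nat.zero_add]
      exact (le_foldl_max_mem (L.take 16) 0).2.1 _ (getD_mem_take hi (by omega))
    | succ q =>
      rw [List.getD_cons_succ]
      have h := le_blockMax_getD n (L.drop 16) q i (by omega) hi (by rw [List.length_drop]; omega)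
      rw [List.getD_eq_getElem?_getD, List.getD_eq_getElem?_getD, List.getElem?_drop] at h
      rw [List.getD_eq_getElem?_getD, List.getD_eq_getElem?_getD, show 16 * (q + 1) + i = 16 + (16 * q + i) by ring]
      exact h

/-- Lengths: `blockMin n L` has `n` entries. [folklore] -/
theorem blockMin_length : ∀ (n : ℕ) (L : List ℕ), (blockMin n L).length = n
  | 0, L => by simp [blockMin]
  | n + 1, L => by rw [blockMin, List.length_cons, blockMin_length n]

/-- Lengths: `blockMax n L` has `n` entries. [folklore] -/
theorem blockMax_length : ∀ (n : ℕ) (L : List ℕ), (blockMax n L).length = n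
  | 0, L => by simp [blockMax]
  | n + 1, L => by rw [blockMax, List.length_cons, blockMax_length n]

/-- The block minima are `< 2⁴⁸` when all cells are. [folklore] -/
theorem blockMin_lt : ∀ (n : ℕ) (L : List ℕ), (∀ x ∈ L, x < 2 ^ 48) → ∀ j < (blockMin n L).length,
    (blockMin n L).getD j 0 < 2 ^ 48
  | 0, L, _, j, hj => by simp [blockMin] at hj
  | n + 1, L, hL, j, hj => by
    rw [blockMin]
    cases j with
    | zero =>
      rw [List.getD_cons_zero]
      rcases foldl_min_eq_or_mem (L.take 16) (L.headD 0) with h | h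
      · rw [h]
        cases L with
        | nil => simp
        | cons x L' => exact hL x List.mem_cons_self
      · exact hL _ (List.mem_of_mem_take h)
    | succ j =>
      rw [List.getD_cons_succ]
      refine blockMin_lt n (L.drop 16) (fun x hx => hL x (List.mem_of_mem_drop hx)) j ?_
      rw [blockMin, List.length_cons] at hj; omega

/-- The block maxima are `< 2⁴⁸` when all cells are. [folklore] -/
theorem blockMax_lt : ∀ (n : ℕ) (L : List ℕ), (∀ x ∈ L, x < 2 ^ 48) → ∀ j < (blockMax n L).length,
    (blockMax n L).getD j 0 < 2 ^ 48
  | 0, L, _, j, hj => by simp [blockMax] at hj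
  | n + 1, L, hL, j, hj => by
    rw [blockMax]
    cases j with
    | zero =>
      rw [List.getD_cons_zero]
      rcases (le_foldl_max_mem (L.take 16) 0).2.2 with h | h
      · rw [h]; norm_num
      · exact hL _ (List.mem_of_mem_take h)
    | succ j =>
      rw [List.getD_cons_succ]
      refine blockMax_lt n (L.drop 16) (fun x hx => hL x (List.mem_of_mem_drop hx)) j ?_
      rw [blockMax, List.length_cons] at hj; omega

/-! ### The range lookups bound the cells -/

/-- **Lower lookup**: for a cell list `L` (entries `< 2⁴⁸`, the cells `60000, 60001, …`) packed as
`pack48 (blockMin n L)`, every cell `m ∈ [lo, hi)` with `60000 ≤ lo` and `hi ≤ 60000 + 16n`, `m − 60000 < |L|`,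
satisfies `phiLoRange (pack48 (blockMin n L)) lo hi ≤ L_{m − 60000}`. [folklore] -/
theorem phiLoRange_le {L : List ℕ} (hL : ∀ x ∈ L, x < 2 ^ 48) {n lo hi m : ℕ} (hlo : 60000 ≤ lo)
    (hhi : hi ≤ 60000 + 16 * n) (hm1 : lo ≤ m) (hm2 : m < hi) (hmL : m - 60000 < L.length) :
    phiLoRange (pack48 (blockMin n L)) lo hi ≤ L.getD (m - 60000) 0 := by
  unfold phiLoRange
  set q := (m - 60000) / 16 with hq
  set i := (m - 60000) % 16 with hidef
  have hqn : q < n := by rw [hq]; omega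
  have hi16 : i < 16 := by rw [hidef]; exact Nat.mod_lt _ (by norm_num)
  have hmq : m - 60000 = 16 * q + i := by rw [hq, hidef]; omega
  have hq1 : (lo - 60000) / 16 ≤ q := by rw [hq]; exact Nat.div_le_div_right (by omega)
  have hq2 : q ≤ (hi - 1 - 60000) / 16 := by rw [hq]; exact Nat.div_le_div_right (by omega)
  have h1 := rangeMin_le_digit (pack48 (blockMin n L)) ((hi - 1 - 60000) / 16 - (lo - 60000) / 16)
    ((lo - 60000) / 16) (q - (lo - 60000) / 16) (by omega)
  rw [show (lo - 60000) / 16 + (q - (lo - 60000) / 16) = q by omega,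
    digit48_pack48 (blockMin_lt n L hL) q] at h1
  refine h1.trans ?_
  rw [hmq]
  exact blockMin_getD_le n L q i hqn hi16 (by omega)

/-- **Upper lookup**: `L_{m − 60000} ≤ phiHiRange (pack48 (blockMax n L)) lo hi` for every cell `m ∈ [lo, hi)`. [folklore] -/
theorem le_phiHiRange {L : List ℕ} (hL : ∀ x ∈ L, x < 2 ^ 48) {n lo hi m : ℕ} (hlo : 60000 ≤ lo)
    (hhi : hi ≤ 60000 + 16 * n) (hm1 : lo ≤ m) (hm2 : m < hi) (hmL : m - 60000 < L.length) :
    L.getD (m - 60000) 0 ≤ phiHiRange (pack48 (blockMax n L)) lo hi := by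
  unfold phiHiRange
  set q := (m - 60000) / 16 with hq
  set i := (m - 60000) % 16 with hidef
  have hqn : q < n := by rw [hq]; omega
  have hi16 : i < 16 := by rw [hidef]; exact Nat.mod_lt _ (by norm_num)
  have hmq : m - 60000 = 16 * q + i := by rw [hq, hidef]; omega
  have hq1 : (lo - 60000) / 16 ≤ q := by rw [hq]; exact Nat.div_le_div_right (by omega)
  have hq2 : q ≤ (hi - 1 - 60000) / 16 := by rw [hq]; exact Nat.div_le_div_right (by omega)
  have h1 := digit_le_rangeMax (pack48 (blockMax n L)) ((hi - 1 - 60000) / 16 - (lo - 60000) / 16)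
    ((lo - 60000) / 16) (q - (lo - 60000) / 16) (by omega)
  rw [show (lo - 60000) / 16 + (q - (lo - 60000) / 16) = q by omega,
    digit48_pack48 (blockMax_lt n L hL) q] at h1
  refine le_trans ?_ h1
  rw [hmq]
  exact le_blockMax_getD n L q i hqn hi16 (by omega)

end Summit.Parity.GeneralizedHardyLittlewood.FordMaynardSieveConst01651SieveConst01651
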